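import Literature.Barriers.CriticalPhenomena.FKParafermionicHalfCauchyRiemann
import HarnessLib

/-!
# Bergman split of the interior coefficient of the weighted half-CR Green identity
# (crux `ParafermionToSLESixFamilies`, stmt-CriticalPhenomena-11389; first lemma of the round-2 idea
# `bergman-split-sum-rules`, served to this lead as the evidence file `SketchProofs.lean`)

In the `ψ`-weighted Green identity of the half Cauchy–Riemann relations
(`Theorems/…IicWeightedGreen.lean`, `sum_weighted_halfCRForm_eq`) the interior coefficient of the corner `k`
at the medial vertex `p = (x, i)` (the lattice edge `s(x, x + eᵢ)`, `medialVertexOf p`) is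
`HalfCRGreen.coeff c k * (ψ p - ψ (HalfCRGreen.twin x i k))`. This file computes it in closed form, at
every mesh `δ`, for the two LINEAR weights built from the position `medialPoint δ (medialVertexOf p)` of
the medial vertex and the critical coefficient `c = I`:

* antiholomorphic weight `ψ = conj ∘ position`: the coefficient is the SAME constant `δ (1 + I) / 2` for all
  four corners (`coeff_mul_conj_sub`), so the interior pairing sees only the corner-symmetric sum, i.e. the
  crux's vertex observable;
* holomorphic weight `ψ = position`: the coefficient ALTERNATES, `δ (1 - I) / 2 · (-1)^k`
  (`coeff_mul_sub`), so the interior pairing sees only the diagonal-staggered mode `Σ_k (-1)^k F(corner k)`.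

Pure table bookkeeping over the barrier file's certified tables `medialVertexOf`, `HalfCRGreen.coeff`,
`HalfCRGreen.twin` (adapted from the ideator's `SketchProofs.lean`, restated in the tree's vocabulary
`medialPoint δ ∘ medialVertexOf` instead of a private position function, and at general mesh).
-/

noncomputable section

open Literature.Probability.LatticeModels
open Literature.Barriers.CriticalPhenomena
open Literature.Barriers.CriticalPhenomena.HalfCRGreen

namespace Summit.CriticalPhenomena.CardyFormulaZ2.Cruxes.ParafermionToSLESixFamilies.BergmanSplit

/-- Real part of the position of the medial vertex `(x, i)` at mesh `δ`: `δ (x₀ + [i = 0] / 2)`. -/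
theorem medialPoint_medialVertexOf_re (δ : ℝ) (x : Site 2) (i : Fin 2) :
    (medialPoint δ (medialVertexOf (x, i))).re = δ * (x 0 + if i = 0 then 1 / 2 else 0) := by
  fin_cases i
  · simp [medialVertexOf, medialPoint_mk, Complex.add_re, meshPoint_re, Pi.add_apply]; ring
  · simp [medialVertexOf, medialPoint_mk, Complex.add_re, meshPoint_re, Pi.add_apply]

/-- Imaginary part of the position of the medial vertex `(x, i)` at mesh `δ`: `δ (x₁ + [i = 1] / 2)`. -/
theorem medialPoint_medialVertexOf_im (δ : ℝ) (x : Site 2) (i : Fin 2) :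
    (medialPoint δ (medialVertexOf (x, i))).im = δ * (x 1 + if i = 0 then 0 else 1 / 2) := by
  fin_cases i
  · simp [medialVertexOf, medialPoint_mk, Complex.add_im, meshPoint_im, Pi.add_apply]
  · simp [medialVertexOf, medialPoint_mk, Complex.add_im, meshPoint_im, Pi.add_apply]; ring

/-- **Bergman split, analytic half.** For the holomorphic linear weight `ψ = medialPoint δ ∘ medialVertexOf`
and the critical coefficient `c = I`, the interior coefficient of the corner `k` at `(x, i)` alternates:
`coeff I k · (ψ (x, i) − ψ (twin x i k)) = δ (1 − I)/2 · (−1)^k`. -/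
theorem coeff_mul_sub : ∀ (δ : ℝ) (x : Site 2) (i : Fin 2) (k : Fin 4), coeff Complex.I k * (medialPoint δ (medialVertexOf (x, i)) - medialPoint δ (medialVertexOf (twin x i k))) = (δ : ℂ) * ((1 - Complex.I) / 2 * (-1 : ℂ) ^ (k : ℕ)) := by
  intro δ x i k
  -- tabulate the sign `(-1)^k` so that `simp` can evaluate it corner by corner
  have hk : ((-1 : ℂ) ^ (k : ℕ)) = ![1, -1, 1, -1] k := by fin_cases k <;> norm_num
  rw [hk]
  apply Complex.ext
  · fin_cases i <;> fin_cases k <;>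
      simp [twin, Complex.mul_re, medialPoint_medialVertexOf_re, medialPoint_medialVertexOf_im,
        Pi.add_apply, Pi.sub_apply] <;> ring
  · fin_cases i <;> fin_cases k <;>
      simp [twin, Complex.mul_im, medialPoint_medialVertexOf_re, medialPoint_medialVertexOf_im,
        Pi.add_apply, Pi.sub_apply] <;> ring

/-- **Bergman split, anti-analytic half.** For the antiholomorphic linear weight
`ψ = conj ∘ medialPoint δ ∘ medialVertexOf` and `c = I`, the interior coefficient of the corner `k` at
`(x, i)` is the same constant for all four corners: `coeff I k · (ψ (x, i) − ψ (twin x i k)) = δ (1 + I)/2`. -/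
theorem coeff_mul_conj_sub : ∀ (δ : ℝ) (x : Site 2) (i : Fin 2) (k : Fin 4), coeff Complex.I k * ((starRingEnd ℂ) (medialPoint δ (medialVertexOf (x, i))) - (starRingEnd ℂ) (medialPoint δ (medialVertexOf (twin x i k)))) = (δ : ℂ) * ((1 + Complex.I) / 2) := by
  intro δ x i k
  apply Complex.ext
  · fin_cases i <;> fin_cases k <;>
      simp [twin, Complex.mul_re, Complex.sub_re, Complex.sub_im, Complex.conj_re, Complex.conj_im,
        medialPoint_medialVertexOf_re, medialPoint_medialVertexOf_im, Pi.add_apply, Pi.sub_apply] <;> ring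
  · fin_cases i <;> fin_cases k <;>
      simp [twin, Complex.mul_im, Complex.sub_re, Complex.sub_im, Complex.conj_re, Complex.conj_im,
        medialPoint_medialVertexOf_re, medialPoint_medialVertexOf_im, Pi.add_apply, Pi.sub_apply] <;> ring

/-- The two splits add up: for the REAL-PART weight `ψ = re ∘ position` (half the sum of the two linear
weights) the interior coefficient is `δ/4 · ((1 + I) + (1 − I)(−1)^k)`, i.e. `δ/2` on the even (NW, SE)
corners and `δ I/2` on the odd (NE, SW) corners — the raw Green identity mixes the vertex observable and
the staggered mode with equal weight, which is what the split undoes. -/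
theorem coeff_mul_re_sub (δ : ℝ) (x : Site 2) (i : Fin 2) (k : Fin 4) :
    coeff Complex.I k *
        (((medialPoint δ (medialVertexOf (x, i))).re : ℂ) -
          ((medialPoint δ (medialVertexOf (twin x i k))).re : ℂ)) =
      (δ : ℂ) / 4 * ((1 + Complex.I) + (1 - Complex.I) * (-1 : ℂ) ^ (k : ℕ)) := by
  have h1 := coeff_mul_sub δ x i k
  have h2 := coeff_mul_conj_sub δ x i k
  have hre : ∀ w : ℂ, ((w.re : ℂ)) = (w + (starRingEnd ℂ) w) / 2 := fun w => by
    rw [Complex.add_conj]; push_cast; ring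
  rw [hre, hre]
  linear_combination (1 / 2 : ℂ) * h1 + (1 / 2 : ℂ) * h2

end Summit.CriticalPhenomena.CardyFormulaZ2.Cruxes.ParafermionToSLESixFamilies.BergmanSplit
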